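import Literature.MeasureTheory.Group.ConjugationFamilyFibres   -- ★ `mem_normalizer_of_conj_eq` (conjugating one `T`-regular element to another normalises `T`); currency `(T, R, hRT, hRc, hW)`
import Mathlib.Algebra.Group.Conj
import Mathlib.Data.Set.Card
import HarnessLib

/-!
# The conjugates of a `T`-regular element inside its own Cartan subgroup `T` form a torsor under `N_G(T) ∕ T` (Harish-Chandra 1970 Lemma 42; Rogawski 1990 §12.5)

Topic `GroupTheory`; namespace `Literature.GroupTheory`.  THEOREMS ONLY (no definition, no instance, no notation, no named fact, no `sorry`); Mathlib + the ★ generic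
engine `Literature.MeasureTheory.Group.ConjugationFamilyFibres` (its letters `T`, `R`, `hRT : ∀ t : ↥T, ↑t ∈ R → Z(t) = T`, `hRc : R` conjugation-stable,
`hW : [N_G(T) : T] ≠ 0` are used VERBATIM).  Cell `pub/hodgecm-mathlib`, crux H413 = `stmt-HodgeConjecture-24833` (supports-only lane, count-neutral), road «UP-TR»
(`F0/P3/F0P3-p02/g23/ROAD-UP-TR.v2.F0P3p02g23.md` §B), brick **(H6-T) «TORSOR»** — the input «`#(T_c ∩ c) = [N_H(T_c) : T_c]`» of (N5) CLAIM-P (§A (A-2)) and of (A-5).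

THE MATHEMATICS.  Let `T ≤ G`, `t₀ ∈ T` with `Z_G(t₀) = T` («`t₀` is `T`-regular», `t₀ ∈ R`), and suppose every `G`-conjugate of `t₀` that lies in `T` is again `T`-regular (`R` is
conjugation-stable and `Z_G(t) = T` on `T ∩ R`).  Then `n ↦ n t₀ n⁻¹` maps `N_G(T)` ONTO `{s ∈ T ∣ s ∼_G t₀}` (a conjugator `g` with `g t₀ g⁻¹ ∈ T` normalises `T`, ★
`mem_normalizer_of_conj_eq`), with fibres the left cosets of `T = Z_G(t₀) ≤ N_G(T)`; so `{s ∈ T ∣ s ∼_G t₀}` is in bijection with `N_G(T) ∕ T`: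
**`Nat.card {s ∈ T ∣ IsConj t₀ s} = [N_G(T) : T]`** (`Subgroup.index` of `T.subgroupOf N_G(T)`; both sides `0` when infinite), finite of that cardinality when `[N_G(T) : T] ≠ 0`,
and an explicit `Finset` with characterising membership (road «UP-TR» cond. (2): no free `Finset` letter).  No commutativity of `T` is needed.
* `conj_mem_of_mem_normalizer` — `n ∈ N_G(T)`, `t ∈ T` ⇒ `n t n⁻¹ ∈ T`;
* `mem_normalizer_of_conj_mem` — `t₀ ∈ T ∩ R`, `g t₀ g⁻¹ ∈ T` ⇒ `g ∈ N_G(T)`;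
* `conj_eq_conj_iff_inv_mul_mem` — `n t₀ n⁻¹ = m t₀ m⁻¹ ↔ m⁻¹ n ∈ T` (`Z_G(t₀) = T`);
* `setOf_mem_isConj_eq_image_normalizer` — `{s ∈ T ∣ s ∼ t₀} = (n ↦ n t₀ n⁻¹) '' N_G(T)`;
* **`exists_equiv_quotient_normalizer_setOf_mem_isConj`** — the torsor itself: `∃ e : N_G(T) ⧸ T ≃ {s ∈ T ∣ s ∼ t₀}, e (n T) = n t₀ n⁻¹` (re-indexing device for orbit sums);
* **`natCard_setOf_mem_isConj_eq_index`**, `ncard_setOf_mem_isConj_eq_index` — the torsor count;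
* `finite_setOf_mem_isConj`, `exists_finset_mem_isConj_card_eq_index` — finiteness and the `Finset` form under `hW`.
On `H_v = U(Φ₂)(L⁺_v) × U(Φ₁)(L⁺_v)` with `R = {G-regular}`: `hRT` = ★ `F0P3cStCharTSUpTrCartanFields.centralizer_eq_cartan_of_isLocalGRegular` (p852366), `hRc` = ★
`isLocalGRegular_conj_iff`, `hW` = (H3a).
HONEST LABEL: count-neutral generic group theory; HC_CM is proved only modulo the 7 printed citations (2 remaining: hLiu418 = `stmt-HodgeConjecture-24832`, h413 =
`stmt-HodgeConjecture-24833`) until rung 0 closes.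

## References
* [HarishChandra1970] Harish-Chandra (notes by G. van Dijk), *Harmonic Analysis on Reductive p-adic Groups*, LNM 162 (1970), Lemma 42 (the fibres of `G∕T × T′ → G` are
  `W_T`-torsors).
* [Rogawski1990] J. D. Rogawski, *Automorphic Representations of Unitary Groups in Three Variables*, Ann. of Math. Stud. 123 (1990), §12.5 p. 182 (the factor
  `[N(T):T]⁻¹` = `|W(T)|⁻¹` in the Weyl integration formula), §3.6 pp. 28–31.
-/

set_option autoImplicit false

namespace Literature.GroupTheory

open Literature.MeasureTheory.Group

section Torsor

variable {G : Type*} [Group G] (T : Subgroup G)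

/-- `n ∈ N_G(T)`, `t ∈ T` ⇒ `n t n⁻¹ ∈ T` (Mathlib `Subgroup.mem_normalizer_iff`). [cite: HarishChandra1970, Lemma 42] -/
theorem conj_mem_of_mem_normalizer {n t : G} (hn : n ∈ Subgroup.normalizer (T : Set G)) (ht : t ∈ T) : n * t * n⁻¹ ∈ T :=
  (Subgroup.mem_normalizer_iff.1 hn t).1 ht

variable (R : Set G) (hRT : ∀ t : ↥T, (t : G) ∈ R → Subgroup.centralizer {(t : G)} = T) (hRc : ∀ g x : G, x ∈ R → g * x * g⁻¹ ∈ R)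

include hRT hRc in
/-- **A conjugator landing a `T`-regular `t₀ ∈ T` inside `T` normalises `T`**: `t₀ ∈ T ∩ R`, `g t₀ g⁻¹ ∈ T` ⇒ `g ∈ N_G(T)` (both `t₀` and `g t₀ g⁻¹ ∈ T ∩ R` have centraliser `T`;
★ `mem_normalizer_of_conj_eq`). [cite: HarishChandra1970, Lemma 42] -/
theorem mem_normalizer_of_conj_mem {t₀ : G} (ht₀T : t₀ ∈ T) (ht₀R : t₀ ∈ R) {g : G} (hg : g * t₀ * g⁻¹ ∈ T) :
    g ∈ Subgroup.normalizer (T : Set G) :=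
  mem_normalizer_of_conj_eq T (hRT ⟨t₀, ht₀T⟩ ht₀R) (hRT ⟨g * t₀ * g⁻¹, hg⟩ (hRc g t₀ ht₀R)) rfl

include hRT in
/-- **Fibres of `n ↦ n t₀ n⁻¹`**: `n t₀ n⁻¹ = m t₀ m⁻¹ ↔ m⁻¹ n ∈ T` when `Z_G(t₀) = T` (`t₀ ∈ T ∩ R`). [cite: HarishChandra1970, Lemma 42] -/
theorem conj_eq_conj_iff_inv_mul_mem {t₀ : G} (ht₀T : t₀ ∈ T) (ht₀R : t₀ ∈ R) (n m : G) :
    n * t₀ * n⁻¹ = m * t₀ * m⁻¹ ↔ m⁻¹ * n ∈ T := by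
  rw [← hRT ⟨t₀, ht₀T⟩ ht₀R, Subgroup.mem_centralizer_singleton_iff]
  constructor
  · intro h
    calc m⁻¹ * n * t₀ = m⁻¹ * (n * t₀ * n⁻¹) * n := by group
      _ = m⁻¹ * (m * t₀ * m⁻¹) * n := by rw [h]
      _ = t₀ * (m⁻¹ * n) := by group
  · intro h
    calc n * t₀ * n⁻¹ = m * (m⁻¹ * n * t₀) * n⁻¹ := by group
      _ = m * (t₀ * (m⁻¹ * n)) * n⁻¹ := by rw [h]
      _ = m * t₀ * m⁻¹ := by group

include hRT hRc in
/-- **`{s ∈ T ∣ s ∼_G t₀} = {n t₀ n⁻¹ ∣ n ∈ N_G(T)}`** for `t₀ ∈ T ∩ R`. [cite: HarishChandra1970, Lemma 42] [cite: Rogawski1990, §12.5 p. 182] -/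
theorem setOf_mem_isConj_eq_image_normalizer {t₀ : G} (ht₀T : t₀ ∈ T) (ht₀R : t₀ ∈ R) :
    {s : G | s ∈ T ∧ IsConj t₀ s} = (fun n : G => n * t₀ * n⁻¹) '' (Subgroup.normalizer (T : Set G) : Set G) := by
  ext s
  constructor
  · rintro ⟨hsT, hconj⟩
    obtain ⟨c, hc⟩ := isConj_iff.1 hconj
    refine ⟨c, ?_, hc⟩
    have hcT : (c : G) * t₀ * (c : G)⁻¹ ∈ T := by rw [hc]; exact hsT
    exact mem_normalizer_of_conj_mem T R hRT hRc ht₀T ht₀R hcT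
  · rintro ⟨n, hn, rfl⟩
    exact ⟨conj_mem_of_mem_normalizer T hn ht₀T, isConj_iff.2 ⟨n, rfl⟩⟩

include hRT hRc in
/-- **THE TORSOR: `N_G(T) ∕ T ≃ {s ∈ T ∣ s ∼_G t₀}`, `n T ↦ n t₀ n⁻¹`** for `t₀ ∈ T ∩ R` (onto by `mem_normalizer_of_conj_mem`, fibres = left `T`-cosets by
`conj_eq_conj_iff_inv_mul_mem`; the quotient is by `T.subgroupOf N_G(T)`).  Stated as the EXISTENCE of an `Equiv` with its defining equation on representatives — the re-indexing
device for orbit sums `Σ_{s ∈ T, s ∼ t₀} K s = Σ_{n T ∈ N_G(T)∕T} K (n t₀ n⁻¹)` (`Finset.sum_equiv` ∕ `finsum` along `e`).  No commutativity of `T` is used.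
[cite: HarishChandra1970, Lemma 42] [cite: Rogawski1990, §12.5 p. 182] -/
theorem exists_equiv_quotient_normalizer_setOf_mem_isConj {t₀ : G} (ht₀T : t₀ ∈ T) (ht₀R : t₀ ∈ R) :
    ∃ e : ↥(Subgroup.normalizer (T : Set G)) ⧸ T.subgroupOf (Subgroup.normalizer (T : Set G)) ≃ {s : G // s ∈ T ∧ IsConj t₀ s},
      ∀ n : ↥(Subgroup.normalizer (T : Set G)), (e (QuotientGroup.mk n) : G) = (n : G) * t₀ * (n : G)⁻¹ := by
  classical
  set N : Subgroup G := Subgroup.normalizer (T : Set G) with hN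
  -- the conjugation map on the normaliser, landing in the set
  let f : ↥N → {s : G // s ∈ T ∧ IsConj t₀ s} := fun n =>
    ⟨(n : G) * t₀ * (n : G)⁻¹, conj_mem_of_mem_normalizer T n.2 ht₀T, isConj_iff.2 ⟨(n : G), rfl⟩⟩
  -- it is constant on the left cosets of `T ∩ N = T`
  have hf : ∀ a b : ↥N, QuotientGroup.leftRel (T.subgroupOf N) a b → f a = f b := by
    intro a b hab
    rw [QuotientGroup.leftRel_apply, Subgroup.mem_subgroupOf, Subgroup.coe_mul, Subgroup.coe_inv] at hab
    apply Subtype.ext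
    show (a : G) * t₀ * (a : G)⁻¹ = (b : G) * t₀ * (b : G)⁻¹
    rw [conj_eq_conj_iff_inv_mul_mem T R hRT ht₀T ht₀R]
    -- `b⁻¹ a = (a⁻¹ b)⁻¹ ∈ T`
    have h := T.inv_mem hab
    rwa [mul_inv_rev, inv_inv] at h
  let fbar : ↥N ⧸ T.subgroupOf N → {s : G // s ∈ T ∧ IsConj t₀ s} := Quotient.lift f hf
  have hfbar : ∀ n : ↥N, fbar (QuotientGroup.mk n) = f n := fun _ => rfl
  have hbij : Function.Bijective fbar := by
    constructor
    · intro q₁ q₂ h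
      induction q₁ using QuotientGroup.induction_on with
      | H a =>
        induction q₂ using QuotientGroup.induction_on with
        | H b =>
          rw [hfbar, hfbar] at h
          have h' : (a : G) * t₀ * (a : G)⁻¹ = (b : G) * t₀ * (b : G)⁻¹ := congrArg Subtype.val h
          rw [conj_eq_conj_iff_inv_mul_mem T R hRT ht₀T ht₀R] at h'
          refine QuotientGroup.eq.2 ?_
          rw [Subgroup.mem_subgroupOf, Subgroup.coe_mul, Subgroup.coe_inv]
          have h'' := T.inv_mem h'
          rwa [mul_inv_rev, inv_inv] at h''
    · rintro ⟨s, hsT, hconj⟩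
      obtain ⟨c, hc⟩ := isConj_iff.1 hconj
      have hcT : (c : G) * t₀ * (c : G)⁻¹ ∈ T := by rw [hc]; exact hsT
      refine ⟨QuotientGroup.mk ⟨c, mem_normalizer_of_conj_mem T R hRT hRc ht₀T ht₀R hcT⟩, ?_⟩
      rw [hfbar]
      exact Subtype.ext hc
  exact ⟨Equiv.ofBijective fbar hbij, fun n => rfl⟩

include hRT hRc in
/-- **THE TORSOR COUNT: `#{s ∈ T ∣ s ∼_G t₀} = [N_G(T) : T]`** for `t₀ ∈ T ∩ R` (`Nat.card` on both sides — both `0` in the infinite case; the index is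
`(T.subgroupOf N_G(T)).index`). [cite: HarishChandra1970, Lemma 42] [cite: Rogawski1990, §12.5 p. 182] -/
theorem natCard_setOf_mem_isConj_eq_index {t₀ : G} (ht₀T : t₀ ∈ T) (ht₀R : t₀ ∈ R) :
    Nat.card {s : G // s ∈ T ∧ IsConj t₀ s} = (T.subgroupOf (Subgroup.normalizer (T : Set G))).index := by
  obtain ⟨e, -⟩ := exists_equiv_quotient_normalizer_setOf_mem_isConj T R hRT hRc ht₀T ht₀R
  rw [Subgroup.index]
  exact (Nat.card_congr e).symm

include hRT hRc in
/-- The torsor count in `Set.ncard` currency: `{s ∈ T ∣ s ∼_G t₀}.ncard = [N_G(T) : T]`. [cite: HarishChandra1970, Lemma 42] [cite: Rogawski1990, §12.5 p. 182] -/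
theorem ncard_setOf_mem_isConj_eq_index {t₀ : G} (ht₀T : t₀ ∈ T) (ht₀R : t₀ ∈ R) :
    {s : G | s ∈ T ∧ IsConj t₀ s}.ncard = (T.subgroupOf (Subgroup.normalizer (T : Set G))).index := by
  rw [← natCard_setOf_mem_isConj_eq_index T R hRT hRc ht₀T ht₀R, ← Nat.card_coe_set_eq]
  rfl

variable (hW : (T.subgroupOf (Subgroup.normalizer (T : Set G))).index ≠ 0)

include hRT hRc hW in
/-- **Finiteness**: under `[N_G(T) : T] ≠ 0` the set `{s ∈ T ∣ s ∼_G t₀}` is finite (`t₀ ∈ T ∩ R`). [cite: HarishChandra1970, Lemma 42] [cite: Rogawski1990, §12.5 p. 182] -/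
theorem finite_setOf_mem_isConj {t₀ : G} (ht₀T : t₀ ∈ T) (ht₀R : t₀ ∈ R) : {s : G | s ∈ T ∧ IsConj t₀ s}.Finite := by
  have h : Nat.card ↥({s : G | s ∈ T ∧ IsConj t₀ s}) ≠ 0 := by
    rw [Nat.card_coe_set_eq, ncard_setOf_mem_isConj_eq_index T R hRT hRc ht₀T ht₀R]; exact hW
  exact Set.finite_coe_iff.1 (Nat.finite_of_card_ne_zero h)

include hRT hRc hW in
/-- **The `Finset` form WITH its characterising membership** (road «UP-TR» cond. (2)): under `[N_G(T) : T] ≠ 0` there is `S : Finset G` with `s ∈ S ↔ s ∈ T ∧ s ∼_G t₀` and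
`S.card = [N_G(T) : T]`. [cite: HarishChandra1970, Lemma 42] [cite: Rogawski1990, §12.5 p. 182] -/
theorem exists_finset_mem_isConj_card_eq_index {t₀ : G} (ht₀T : t₀ ∈ T) (ht₀R : t₀ ∈ R) :
    ∃ S : Finset G, (∀ s, s ∈ S ↔ s ∈ T ∧ IsConj t₀ s) ∧ S.card = (T.subgroupOf (Subgroup.normalizer (T : Set G))).index := by
  have hfin := finite_setOf_mem_isConj T R hRT hRc hW ht₀T ht₀R
  refine ⟨hfin.toFinset, fun s => by rw [Set.Finite.mem_toFinset, Set.mem_setOf_eq], ?_⟩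
  rw [← ncard_setOf_mem_isConj_eq_index T R hRT hRc ht₀T ht₀R, Set.ncard_eq_toFinset_card _ hfin]

end Torsor

end Literature.GroupTheory
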